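import Mathlib
import HarnessLib
import Summits.Ventures.LatticeQCDFlow.Exactness.SUNWilsonHMCForce
import Summits.Ventures.LatticeQCDFlow.Exactness.CabibboMarinariORSweep

/-!
# The engine's multi-step `SU(N)` HMC AS RUN — with its own Wilson force — converges to the Wilson measure from every start for all trajectory lengths below a threshold that does not depend on the lattice size

HONEST FRAMING: exact (Metropolis-corrected) sampling algorithms for lattice gauge theory;
figures of merit are autocorrelation/cost numbers at stated couplings and volumes; no
continuum-physics claim.

Venture `LatticeQCDFlow` (cell pub-lqcd), topic `Exactness`, FANOUT row 21 (`su3-base`: the 4-d `SU(3)`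
baseline arm `E2 = PBC-HMC` = the engine `latflow.core.hmc.HMC(f, β_eng, 'leapfrog').trajectory(τ, nstep)`
on the periodic Wilson action).  NEW WORK of the cell over the tree (`SUNMultiStepLeapfrogHMCEngine.lean`,
row 9: `engine_sunLeapfrogHMCN_uniformlyErgodic` / `_invariant_unique` for ANY measurable momentum increment
bounded by `b` and `K_g`-Lipschitz, `trajLength_threshold_arith`, `measurable_halfKick_sun`;
`SUNLeapfrogHMCWilson.lean`: `β S_W` is bounded and its Gibbs law is the Literature Wilson measure;
`SUNWilsonHMCForce.lean`, row 21: the engine's force `sunWilsonForce N β` is measurable, bounded by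
`sunWilsonForceSup N d β` and `sunWilsonForceLip N d β`-Lipschitz, constants free of `L`;
`CabibboMarinariORSweep.suRep`: the defining representation).  The Wilson action and measure are the
Literature definitions of `ConstructiveQFTWave0` (`wilsonAction`, `wilsonMeasure`), used by name; nothing is
cited as a fact; no number.  Printed counterparts, NAMED ONLY: Duane–Kennedy–Pendleton–Roweth 1987 (HMC);
Mackenzie 1989 (fixed long trajectories need not be ergodic).

`SUNMultiStepLeapfrogHMCEngine.lean` listed as NOT CLAIMED "that the engine's force routine `−½ε∂(βS_W)` is
Lipschitz with a stated constant … the statements cover ANY bounded Lipschitz increment".  Row 9 GEN-19's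
`SUNForceRegularity.lean` discharges it QUALITATIVELY for every `C¹` ambient force law (compactness: some
`F_max, K_F`, hence some `τ₀`, all depending on the lattice size through the configuration ball); row 21's force
file discharges it for the Wilson force with EXPLICIT local constants, so here the threshold is uniform in the
volume (ownership split of record, LEAD LINE 331: row 9 = the engine's HMC as run converges per volume; row 21 =
the volume-uniform threshold):

* `sunWilsonTrajThreshold N d β = min s_N (min (s_N/(3F+1)) √(s_N/(K+1)))` with `s_N` the short-trajectory
  threshold of the engine's coordinates (`sunShortTrajThreshold`), `F = sunWilsonForceSup N d β`,
  `K = sunWilsonForceLip N d β`; **`sunWilsonTrajThreshold_pos`**.  It depends on `N`, `d`, `β` ONLY.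
* **`wilsonForce_sunLeapfrogHMCN_uniformlyErgodic`** — on EVERY torus `(ℤ/L)^d` (`L ≥ 1`), for every
  `n ≥ 1` and `ε > 0` with `nε ≤ sunWilsonTrajThreshold N d β`: the engine's `n`-step P-first leapfrog HMC
  with its momenta / kinetic term `−Σ tr P²`, the half kick `−(ε/2)·sunWilsonForce N β` (= the engine's
  `_upd_P` with `c = ε/2` at `β_eng = Nβ`) and the Metropolis test on `β S_W + T` satisfies
  `|μ₀Kᵗ(A) − wilsonMeasure (suRep N) β (A)| ≤ (1 − δ)^{⌊t/(k+1)⌋}` for some `k`, `δ ∈ (0,1]`, EVERY initial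
  law `μ₀`, every `t`, every set `A`; **`wilsonMeasure_unique_invariant_wilsonForce_sunLeapfrogHMCN`** — the
  Wilson measure is its ONLY invariant probability law;
* **`wilsonForce_sunLeapfrogHMCN_uniformlyErgodic_allVolumes`** — the same with the quantifiers in the
  honest order: `∃ τ₀ > 0, ∀ L, ∀ n ≥ 1, ∀ ε > 0, nε ≤ τ₀ → …` — ONE trajectory-length threshold for all
  lattice sizes.

NOT CLAIMED: any usable value of the threshold (it contains the inverse-function-theorem radii of row 9's
chart and `‖coordOf‖`); the engine's usual `τ ≈ 1`; that the RATE `δ, k` is uniform in `L` (it is not claimed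
and not expected: this is a qualitative certificate, the autocorrelation numbers are MEASURED by row 21's arm
`E2`); OMF integrators / `tau_jitter`; open boundary conditions; floating point.
-/

noncomputable section

namespace Summit.Ventures.LatticeQCDFlow.Exactness

open MeasureTheory ProbabilityTheory ProbabilityTheory.Kernel Set Function
open Literature.MathematicalPhysics.QuantumFieldTheory
open scoped ENNReal Matrix Matrix.Norms.Operator NNReal

set_option backward.isDefEq.respectTransparency false

variable (N : ℕ) [NeZero N] (d : ℕ) (β : ℝ)

/-- **The trajectory-length threshold** `τ₀(N, d, β) = min s_N (min (s_N/(3F+1)) √(s_N/(K+1)))`, `s_N` the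
short-trajectory threshold of the engine's coordinates, `F`, `K` the volume-independent sup and Lipschitz
bounds of the engine's Wilson force.  It does not depend on the lattice size. -/
def sunWilsonTrajThreshold : ℝ :=
  min (sunShortTrajThreshold (sunCoordι N) (sunCoordι_injective N))
    (min (sunShortTrajThreshold (sunCoordι N) (sunCoordι_injective N) / (3 * sunWilsonForceSup N d β + 1))
      (Real.sqrt (sunShortTrajThreshold (sunCoordι N) (sunCoordι_injective N) / (sunWilsonForceLip N d β + 1))))

/-- `τ₀(N, d, β) > 0`. -/
theorem sunWilsonTrajThreshold_pos : 0 < sunWilsonTrajThreshold N d β := by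
  have hs := sunShortTrajThreshold_pos (sunCoordι N) (sunCoordι_injective N)
  have hF := sunWilsonForceSup_nonneg N d β
  have hK := sunWilsonForceLip_nonneg N d β
  unfold sunWilsonTrajThreshold
  exact lt_min hs (lt_min (by positivity) (Real.sqrt_pos.2 (by positivity)))

/-- **THE ENGINE'S `n`-STEP LEAPFROG HMC WITH ITS OWN WILSON FORCE CONVERGES TO THE `SU(N)` WILSON MEASURE
FROM EVERY START**, on every torus `(ℤ/L)^d`, for every `n ≥ 1`, `ε > 0` with `nε ≤ τ₀(N, d, β)`:
there are `k` and `δ ∈ (0, 1]` with `|μ₀Kᵗ(A) − wilsonMeasure (suRep N) β (A)| ≤ (1 − δ)^{⌊t/(k+1)⌋}` for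
EVERY initial law `μ₀`, every `t`, every set `A`.  No hypothesis on the force is left. -/
theorem wilsonForce_sunLeapfrogHMCN_uniformlyErgodic (L : ℕ) [NeZero L] {nstep : ℕ} {ε : ℝ}
    (hn : 1 ≤ nstep) (hε : 0 < ε) (hτ : nstep * ε ≤ sunWilsonTrajThreshold N d β) :
    ∃ k : ℕ, ∃ δ : ℝ, 0 < δ ∧ δ ≤ 1 ∧
      ∀ (μ₀ : Measure (GaugeConfig d L (Matrix.specialUnitaryGroup (Fin N) ℂ))) [IsProbabilityMeasure μ₀]
        (t : ℕ) (A : Set (GaugeConfig d L (Matrix.specialUnitaryGroup (Fin N) ℂ))),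
        |((fun m : Measure (GaugeConfig d L (Matrix.specialUnitaryGroup (Fin N) ℂ)) =>
              m.bind (sunLeapfrogHMCN (sunCoordι N) (sunCoordι_skew N) ε (Measure.addHaar : Measure (SUNCoords N))
                (sunKinetic N) (measurable_halfKick_sun N (measurable_sunWilsonForce N (d := d) (L := L) β) ε)
                (fun U => β * wilsonAction (suRep N) U) nstep))^[t] μ₀).real A
            - (wilsonMeasure (d := d) (L := L) (suRep N) β).real A| ≤ (1 - δ) ^ (t / (k + 1)) := by
  obtain ⟨h1, h2, h3⟩ := trajLength_threshold_arith (sunShortTrajThreshold_pos (sunCoordι N) (sunCoordι_injective N))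
    (sunWilsonForceSup_nonneg N d β) (sunWilsonForceLip_nonneg N d β) hn hε
    (rfl : sunWilsonTrajThreshold N d β = _) hτ
  obtain ⟨s, hs⟩ := exists_bound_smul_wilsonAction_sun N (d := d) (L := L) (suRep N) continuous_suRep β
  rw [← gibbsProbability_smul_wilsonAction_eq N (d := d) (L := L) (suRep N) β]
  refine engine_sunLeapfrogHMCN_uniformlyErgodic N hε hn (measurable_halfKick_sun N (measurable_sunWilsonForce N β) ε)
    (b := ε / 2 * sunWilsonForceSup N d β) (Kg := ε / 2 * sunWilsonForceLip N d β)
    (mul_nonneg (by positivity) (sunWilsonForceSup_nonneg N d β)) (fun U l => ?_)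
    (mul_nonneg (by positivity) (sunWilsonForceLip_nonneg N d β)) (fun U U' => ?_)
    (continuous_smul_wilsonAction (suRep N) continuous_suRep β).measurable hs h1 h2 h3
  · rw [Pi.smul_apply, norm_smul, Real.norm_eq_abs, abs_neg, abs_of_pos (by positivity)]
    exact mul_le_mul_of_nonneg_left (norm_sunWilsonForce_le N β U l) (by positivity)
  · have hsub : (-(ε / 2)) • sunWilsonForce N β U - (-(ε / 2)) • sunWilsonForce N β U' =
        (-(ε / 2)) • (sunWilsonForce N β U - sunWilsonForce N β U') := by rw [smul_sub]
    rw [hsub, norm_smul, Real.norm_eq_abs, abs_neg, abs_of_pos (by positivity), mul_assoc]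
    exact mul_le_mul_of_nonneg_left (norm_sunWilsonForce_sub_le N β U U') (by positivity)

/-- **The Wilson measure is the unique invariant probability law** of the engine's `n`-step leapfrog HMC
with its own Wilson force, under the same volume-independent trajectory-length condition. -/
theorem wilsonMeasure_unique_invariant_wilsonForce_sunLeapfrogHMCN (L : ℕ) [NeZero L] {nstep : ℕ} {ε : ℝ}
    (hn : 1 ≤ nstep) (hε : 0 < ε) (hτ : nstep * ε ≤ sunWilsonTrajThreshold N d β)
    {π' : Measure (GaugeConfig d L (Matrix.specialUnitaryGroup (Fin N) ℂ))} [IsProbabilityMeasure π']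
    (hπ' : Invariant (sunLeapfrogHMCN (sunCoordι N) (sunCoordι_skew N) ε (Measure.addHaar : Measure (SUNCoords N))
      (sunKinetic N) (measurable_halfKick_sun N (measurable_sunWilsonForce N (d := d) (L := L) β) ε)
      (fun U => β * wilsonAction (suRep N) U) nstep) π') :
    π' = wilsonMeasure (d := d) (L := L) (suRep N) β := by
  obtain ⟨h1, h2, h3⟩ := trajLength_threshold_arith (sunShortTrajThreshold_pos (sunCoordι N) (sunCoordι_injective N))
    (sunWilsonForceSup_nonneg N d β) (sunWilsonForceLip_nonneg N d β) hn hε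
    (rfl : sunWilsonTrajThreshold N d β = _) hτ
  obtain ⟨s, hs⟩ := exists_bound_smul_wilsonAction_sun N (d := d) (L := L) (suRep N) continuous_suRep β
  rw [← gibbsProbability_smul_wilsonAction_eq N (d := d) (L := L) (suRep N) β]
  refine engine_sunLeapfrogHMCN_invariant_unique N hε hn (measurable_halfKick_sun N (measurable_sunWilsonForce N β) ε)
    (b := ε / 2 * sunWilsonForceSup N d β) (Kg := ε / 2 * sunWilsonForceLip N d β)
    (mul_nonneg (by positivity) (sunWilsonForceSup_nonneg N d β)) (fun U l => ?_)
    (mul_nonneg (by positivity) (sunWilsonForceLip_nonneg N d β)) (fun U U' => ?_)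
    (continuous_smul_wilsonAction (suRep N) continuous_suRep β).measurable hs h1 h2 h3 hπ'
  · rw [Pi.smul_apply, norm_smul, Real.norm_eq_abs, abs_neg, abs_of_pos (by positivity)]
    exact mul_le_mul_of_nonneg_left (norm_sunWilsonForce_le N β U l) (by positivity)
  · have hsub : (-(ε / 2)) • sunWilsonForce N β U - (-(ε / 2)) • sunWilsonForce N β U' =
        (-(ε / 2)) • (sunWilsonForce N β U - sunWilsonForce N β U') := by rw [smul_sub]
    rw [hsub, norm_smul, Real.norm_eq_abs, abs_neg, abs_of_pos (by positivity), mul_assoc]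
    exact mul_le_mul_of_nonneg_left (norm_sunWilsonForce_sub_le N β U U') (by positivity)

/-- **ONE THRESHOLD FOR ALL LATTICE SIZES.**  For every `N ≥ 1`, `d`, `β` there is `τ₀ > 0` such that on EVERY
torus `(ℤ/L)^d`, for every `n ≥ 1` and `ε > 0` with `nε ≤ τ₀`, the engine's `n`-step leapfrog HMC with its
own Wilson force converges to `wilsonMeasure (suRep N) β` from every initial law, geometrically in total
variation (the rate may depend on everything, including `L`). -/
theorem wilsonForce_sunLeapfrogHMCN_uniformlyErgodic_allVolumes :
    ∃ τ₀ : ℝ, 0 < τ₀ ∧ ∀ (L : ℕ) [NeZero L] (nstep : ℕ) (ε : ℝ), 1 ≤ nstep → 0 < ε → nstep * ε ≤ τ₀ →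
      ∃ k : ℕ, ∃ δ : ℝ, 0 < δ ∧ δ ≤ 1 ∧
        ∀ (μ₀ : Measure (GaugeConfig d L (Matrix.specialUnitaryGroup (Fin N) ℂ))) [IsProbabilityMeasure μ₀]
          (t : ℕ) (A : Set (GaugeConfig d L (Matrix.specialUnitaryGroup (Fin N) ℂ))),
          |((fun m : Measure (GaugeConfig d L (Matrix.specialUnitaryGroup (Fin N) ℂ)) =>
                m.bind (sunLeapfrogHMCN (sunCoordι N) (sunCoordι_skew N) ε (Measure.addHaar : Measure (SUNCoords N))
                  (sunKinetic N) (measurable_halfKick_sun N (measurable_sunWilsonForce N (d := d) (L := L) β) ε)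
                  (fun U => β * wilsonAction (suRep N) U) nstep))^[t] μ₀).real A
              - (wilsonMeasure (d := d) (L := L) (suRep N) β).real A| ≤ (1 - δ) ^ (t / (k + 1)) :=
  ⟨sunWilsonTrajThreshold N d β, sunWilsonTrajThreshold_pos N d β,
    fun L _ _ _ hn hε hτ => wilsonForce_sunLeapfrogHMCN_uniformlyErgodic N d β L hn hε hτ⟩

end Summit.Ventures.LatticeQCDFlow.Exactness

/-! ## (appended) The limit form: the `t`-step law of every event converges to its Wilson probability; a burn-in length for every accuracy, uniform in the start and the event -/

namespace Summit.Ventures.LatticeQCDFlow.Exactness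

open MeasureTheory ProbabilityTheory ProbabilityTheory.Kernel Filter Topology
open Literature.MathematicalPhysics.QuantumFieldTheory

/-- A geometric envelope in the integer-divided exponent tends to zero: `(1 − δ)^{⌊t/(k+1)⌋} → 0` (`0 < δ ≤ 1`). -/
theorem tendsto_pow_div_succ_atTop {δ : ℝ} (hδ : 0 < δ) (hδ1 : δ ≤ 1) (k : ℕ) :
    Tendsto (fun t : ℕ => (1 - δ) ^ (t / (k + 1))) atTop (𝓝 0) := by
  have hdiv : Tendsto (fun t : ℕ => t / (k + 1)) atTop atTop := by
    refine tendsto_atTop_atTop.2 fun b => ⟨b * (k + 1), fun t ht => ?_⟩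
    exact (Nat.le_div_iff_mul_le (Nat.succ_pos k)).2 ht
  exact (tendsto_pow_atTop_nhds_zero_of_lt_one (by linarith) (by linarith)).comp hdiv

variable (N : ℕ) (d : ℕ) (β : ℝ) [NeZero N]

/-- **THE LIMIT FORM (appended, GEN-5 of row 21)**: under the trajectory-length condition, for EVERY initial law and EVERY event
`A`, the probability of `A` after `t` steps of the engine's `n`-step leapfrog HMC with its own Wilson force CONVERGES to
`wilsonMeasure (suRep N) β (A)` as `t → ∞` (from the geometric total-variation envelope of
`wilsonForce_sunLeapfrogHMCN_uniformlyErgodic`). -/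
theorem wilsonForce_sunLeapfrogHMCN_tendsto (L : ℕ) [NeZero L] {nstep : ℕ} {ε : ℝ}
    (hn : 1 ≤ nstep) (hε : 0 < ε) (hτ : nstep * ε ≤ sunWilsonTrajThreshold N d β)
    (μ₀ : Measure (GaugeConfig d L (Matrix.specialUnitaryGroup (Fin N) ℂ))) [IsProbabilityMeasure μ₀]
    (A : Set (GaugeConfig d L (Matrix.specialUnitaryGroup (Fin N) ℂ))) :
    Tendsto (fun t : ℕ =>
        ((fun m : Measure (GaugeConfig d L (Matrix.specialUnitaryGroup (Fin N) ℂ)) =>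
            m.bind (sunLeapfrogHMCN (sunCoordι N) (sunCoordι_skew N) ε (Measure.addHaar : Measure (SUNCoords N))
              (sunKinetic N) (measurable_halfKick_sun N (measurable_sunWilsonForce N (d := d) (L := L) β) ε)
              (fun U => β * wilsonAction (suRep N) U) nstep))^[t] μ₀).real A)
      atTop (𝓝 ((wilsonMeasure (d := d) (L := L) (suRep N) β).real A)) := by
  obtain ⟨k, δ, hδ, hδ1, hbound⟩ := wilsonForce_sunLeapfrogHMCN_uniformlyErgodic N d β L hn hε hτ
  rw [tendsto_iff_norm_sub_tendsto_zero]
  refine squeeze_zero (fun t => norm_nonneg _) (fun t => ?_) (tendsto_pow_div_succ_atTop hδ hδ1 k)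
  rw [Real.norm_eq_abs]
  exact hbound μ₀ t A

/-- **BURN-IN LENGTH FOR A PRESCRIBED ACCURACY, UNIFORM IN THE START AND IN THE EVENT** (appended, GEN-5): under the same
trajectory-length condition, for every `η > 0` there is a number of steps `T` such that for EVERY `t ≥ T`, EVERY initial law `μ₀` and
EVERY event `A`, `|μ₀Kᵗ(A) − wilsonMeasure(A)| ≤ η` — the qualitative content of the geometric envelope in the form a run plan uses
("after `T` trajectories the law is `η`-close in every event, whatever the start"). -/
theorem wilsonForce_sunLeapfrogHMCN_exists_burnin (L : ℕ) [NeZero L] {nstep : ℕ} {ε : ℝ}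
    (hn : 1 ≤ nstep) (hε : 0 < ε) (hτ : nstep * ε ≤ sunWilsonTrajThreshold N d β) {η : ℝ} (hη : 0 < η) :
    ∃ T : ℕ, ∀ t : ℕ, T ≤ t →
      ∀ (μ₀ : Measure (GaugeConfig d L (Matrix.specialUnitaryGroup (Fin N) ℂ))) [IsProbabilityMeasure μ₀]
        (A : Set (GaugeConfig d L (Matrix.specialUnitaryGroup (Fin N) ℂ))),
        |((fun m : Measure (GaugeConfig d L (Matrix.specialUnitaryGroup (Fin N) ℂ)) =>
              m.bind (sunLeapfrogHMCN (sunCoordι N) (sunCoordι_skew N) ε (Measure.addHaar : Measure (SUNCoords N))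
                (sunKinetic N) (measurable_halfKick_sun N (measurable_sunWilsonForce N (d := d) (L := L) β) ε)
                (fun U => β * wilsonAction (suRep N) U) nstep))^[t] μ₀).real A
            - (wilsonMeasure (d := d) (L := L) (suRep N) β).real A| ≤ η := by
  obtain ⟨k, δ, hδ, hδ1, hbound⟩ := wilsonForce_sunLeapfrogHMCN_uniformlyErgodic N d β L hn hε hτ
  obtain ⟨T, hT⟩ := Filter.eventually_atTop.1 ((tendsto_order.1 (tendsto_pow_div_succ_atTop hδ hδ1 k)).2 η hη)
  exact ⟨T, fun t ht μ₀ _ A => (hbound μ₀ t A).trans (hT t ht).le⟩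

end Summit.Ventures.LatticeQCDFlow.Exactness
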